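import Summits.SmoothPoincare4.SmoothPoincare4.Theorems.CongruenceShadowsShadowApproximationStubLayerStepZeroOneTwists
import Summits.SmoothPoincare4.SmoothPoincare4.Theorems.CongruenceShadowsShadowApproximationStubLayerStepZeroOneLie
import HarnessLib

/-!
# Helper IV (the six realisers) for stub `stub_layerStepZeroOne` of line `nilpotent-genus-class`, crux
`CongruenceShadows.ShadowApproximation` (item stmt-SmoothPoincare4-14595)

Genus `3`, notation as in the sibling `…StubLayerStepZeroOneTwists` (`Nᵢ = s4Kernels i`, `γₖ₊₁`, `𝒥₂`,
the symbol maps `θₖ` and the erasing projection `π` of `N₂` as hypotheses on variables).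

* `datum_list_prod_zpow` — DATA ADD ON `𝒥₂`: a product `y = ∏ Ψᵢ ^ nᵢ` (in `Aut S₃`) of elements of `𝒥₂`
  lies in `𝒥₂` and `θ₂(π(y(s)s⁻¹)) = ∑ nᵢ θ₂(π(Ψᵢ(s)s⁻¹))` (level-`2` Johnson calculus).
* **`exists_realisers`** — THE SIX REALISERS: six Goeritz elements `U_k ∈ Stab N₀ ∩ Stab N₁` in `𝒥₂` whose
  degree-two data `θ₂(π(U_k(X_j)X_j⁻¹))` at the cut letters `X_j = b₀, a₁, a₂` are the six twist data of
  the Lie side `…StubLayerStepZeroOneLie` (the literal coordinate table in the eight basic brackets).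
  They are the separating twists `U_k = x_k T_{h_k} x_k⁻¹` with `h = 1,2,1,0,1,2` and `x_k` the landed
  explicit Goeritz elements `z01, z02, e12, z01∘z02, e12⁻¹∘z01, e12∘z02` (inducing `moveZ 0 1 1`,
  `moveZ 0 2 1`, `moveE 1`, … on `H₁`); the data are computed by `datum_conj_twist` from the numerical
  values `F_values` of the homology actions, and compared with the table by `simp`/`module`.
Also: transfer one level up the lower central series (`mem_commutator_sup_of_map_mem₃`), stabilisers of
list products.  No definitions, no notations.  Registered sub-goal: `helper_johnsonTwoDataAdd`.
-/

set_option linter.dupNamespace false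

noncomputable section

open Subgroup Literature.Topology.FourManifolds Literature.Algebra.Lie Multiplicative
open Summit.SmoothPoincare4.SmoothPoincare4.Theorems.NilpotentShadowsStandard.SaturatedTorsorDescent
open scoped commutatorElement

namespace Summit.SmoothPoincare4.SmoothPoincare4.Theorems.ShadowApproximation.NilpotentGenusClass

namespace LayerZeroOne

/-! ## Generalities -/

/-- Transfer one level up: an element of `γ₃` whose image under a surjection `π` onto a free group lies in
`γ₄` lies in `[ker π, G] γ₄`, provided `ker π` has no hidden depth. [folklore] -/
theorem mem_commutator_sup_of_map_mem₃ {G M : Type*} [Group G] [Group M] (π : G →* M)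
    (hπ : Function.Surjective π)
    (hker : π.ker ⊓ (⊤ : Subgroup G).lowerCentralSeries 1 ≤ ⁅π.ker, (⊤ : Subgroup G)⁆)
    {w : G} (hw : w ∈ (⊤ : Subgroup G).lowerCentralSeries 2)
    (h : π w ∈ (⊤ : Subgroup M).lowerCentralSeries 3) :
    w ∈ ⁅π.ker, (⊤ : Subgroup G)⁆ ⊔ (⊤ : Subgroup G).lowerCentralSeries 3 := by
  rw [← map_lcs_eq_of_surjective π hπ 3] at h
  obtain ⟨z, hz, hzw⟩ := h
  have h1 : w * z⁻¹ ∈ π.ker := by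
    rw [MonoidHom.mem_ker, map_mul, map_inv, hzw, mul_inv_cancel]
  have h2 : w * z⁻¹ ∈ π.ker ⊓ (⊤ : Subgroup G).lowerCentralSeries 1 :=
    mem_inf.2 ⟨h1, mul_mem (lcs_antitone (by decide) hw) (inv_mem (lcs_antitone (by decide) hz))⟩
  have e : w = (w * z⁻¹) * z := by rw [inv_mul_cancel_right]
  rw [e]
  exact mul_mem (mem_sup_left (hker h2)) (mem_sup_right hz)

/-- A list product (in `MulAut G`) of stabilisers of `P` stabilises `P`. [folklore] -/
theorem map_list_prod_eq {G : Type*} [Group G] {ι : Type*} (l : List ι) (Φ : ι → MulAut G) (P : Subgroup G)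
    (h : ∀ i, P.map (Φ i).toMonoidHom = P) : P.map (l.map Φ).prod.toMonoidHom = P := by
  induction l with
  | nil => rw [List.map_nil, List.prod_nil]; exact Subgroup.map_id P
  | cons i l ih =>
    rw [List.map_cons, List.prod_cons, MulAut.mul_def,
      show (MulEquiv.trans (l.map Φ).prod (Φ i)).toMonoidHom = (Φ i).toMonoidHom.comp (l.map Φ).prod.toMonoidHom from rfl,
      ← Subgroup.map_map, ih, h i]

/-- Homology actions compose. [folklore] -/
theorem realises_trans {x₁ x₂ : SurfaceGroup 3 ≃* SurfaceGroup 3} {F₁ F₂ : (surfaceGen 3 → ℤ) ≃ₗ[ℤ] (surfaceGen 3 → ℤ)}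
    (h₁ : ∀ s, toAdd (SurfaceGroup.abelianize 3 (x₁ s)) = F₁ (toAdd (SurfaceGroup.abelianize 3 s)))
    (h₂ : ∀ s, toAdd (SurfaceGroup.abelianize 3 (x₂ s)) = F₂ (toAdd (SurfaceGroup.abelianize 3 s))) (s : SurfaceGroup 3) :
    toAdd (SurfaceGroup.abelianize 3 ((x₁.trans x₂) s)) = (F₁.trans F₂) (toAdd (SurfaceGroup.abelianize 3 s)) := by
  rw [MulEquiv.trans_apply, LinearEquiv.trans_apply, h₂, h₁]

/-- Homology actions invert. [folklore] -/
theorem realises_symm {x : SurfaceGroup 3 ≃* SurfaceGroup 3} {F : (surfaceGen 3 → ℤ) ≃ₗ[ℤ] (surfaceGen 3 → ℤ)}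
    (h : ∀ s, toAdd (SurfaceGroup.abelianize 3 (x s)) = F (toAdd (SurfaceGroup.abelianize 3 s))) (s : SurfaceGroup 3) :
    toAdd (SurfaceGroup.abelianize 3 (x.symm s)) = F.symm (toAdd (SurfaceGroup.abelianize 3 s)) := by
  have h1 := h (x.symm s)
  rw [MulEquiv.apply_symm_apply] at h1
  rw [h1, LinearEquiv.symm_apply_apply]

section Symbols

variable (θ : ℕ → FreeGroup (Fin 3) → FreeLieAlgebra ℤ (Fin 3))
  (hadd : ∀ k, ∀ x ∈ (⊤ : Subgroup (FreeGroup (Fin 3))).lowerCentralSeries k,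
    ∀ y ∈ (⊤ : Subgroup (FreeGroup (Fin 3))).lowerCentralSeries k, θ k (x * y) = θ k x + θ k y)
  (hker : ∀ k, ∀ x ∈ (⊤ : Subgroup (FreeGroup (Fin 3))).lowerCentralSeries k,
    θ k x = 0 ↔ x ∈ (⊤ : Subgroup (FreeGroup (Fin 3))).lowerCentralSeries (k + 1))
  (hof : ∀ i : Fin 3, θ 0 (FreeGroup.of i) = FreeLieAlgebra.of ℤ i)
  (hbr : ∀ j k, ∀ x ∈ (⊤ : Subgroup (FreeGroup (Fin 3))).lowerCentralSeries j,
    ∀ y ∈ (⊤ : Subgroup (FreeGroup (Fin 3))).lowerCentralSeries k, θ (j + k + 1) ⁅x, y⁆ = ⁅θ j x, θ k y⁆)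
  (π : SurfaceGroup 3 →* FreeGroup (Fin 3))
  (hπof : ∀ (h : Fin 3) (b : Bool), π (PresentedGroup.of (h, b)) = if b = (![true, false, false] : Fin 3 → Bool) h then 1 else FreeGroup.of h)

include hadd hker in
/-- **Data add on `𝒥₂`**: the product `y = ∏ Ψᵢ ^ nᵢ` (in `Aut S₃`) of elements of `𝒥₂` lies in `𝒥₂` and
`θ₂(π(y(s)s⁻¹)) = ∑ nᵢ θ₂(π(Ψᵢ(s)s⁻¹))`. [folklore] -/
theorem datum_list_prod_zpow {ι : Type*} (l : List ι) (Ψ : ι → SurfaceGroup 3 ≃* SurfaceGroup 3) (n : ι → ℤ)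
    (hΨ : ∀ i, ∀ s, Ψ i s * s⁻¹ ∈ (⊤ : Subgroup (SurfaceGroup 3)).lowerCentralSeries 2) (s : SurfaceGroup 3) :
    (∀ s, (l.map fun i => ((Ψ i : MulAut (SurfaceGroup 3)) ^ n i : MulAut (SurfaceGroup 3))).prod s * s⁻¹ ∈
      (⊤ : Subgroup (SurfaceGroup 3)).lowerCentralSeries 2) ∧
    θ 2 (π ((l.map fun i => ((Ψ i : MulAut (SurfaceGroup 3)) ^ n i : MulAut (SurfaceGroup 3))).prod s * s⁻¹)) =
      (l.map fun i => n i • θ 2 (π (Ψ i s * s⁻¹))).sum := by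
  obtain ⟨h1, h2⟩ := jk_list_prod_zpow (k := 2) (by norm_num) l Ψ n hΨ
  refine ⟨h1, ?_⟩
  have hmem : ∀ l' : List ι, (l'.map fun i => (Ψ i s * s⁻¹) ^ n i).prod ∈
      (⊤ : Subgroup (SurfaceGroup 3)).lowerCentralSeries 2 := fun l' =>
    list_prod_mem fun x hx => by
      obtain ⟨i, -, rfl⟩ := List.mem_map.1 hx
      exact zpow_mem (hΨ i s) _
  have h3 : (((l.map fun i => ((Ψ i : MulAut (SurfaceGroup 3)) ^ n i : MulAut (SurfaceGroup 3))).prod s * s⁻¹ :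
      SurfaceGroup 3) : SurfaceGroup 3 ⧸ (⊤ : Subgroup (SurfaceGroup 3)).lowerCentralSeries 3) =
      (((l.map fun i => (Ψ i s * s⁻¹) ^ n i).prod : SurfaceGroup 3) : SurfaceGroup 3 ⧸ _) := by
    rw [h2 s, ← QuotientGroup.mk'_apply, map_list_prod, List.map_map]
    refine congrArg List.prod (List.map_congr_left fun i _ => ?_)
    rw [Function.comp_apply, map_zpow, QuotientGroup.mk'_apply]
  have key : ∀ l' : List ι, θ 2 (π ((l'.map fun i => (Ψ i s * s⁻¹) ^ n i).prod)) =
      (l'.map fun i => n i • θ 2 (π (Ψ i s * s⁻¹))).sum := by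
    intro l'
    induction l' with
    | nil => simp only [List.map_nil, List.prod_nil, List.sum_nil, map_one]; exact theta_one θ hadd 2
    | cons i l' ih =>
      rw [List.map_cons, List.prod_cons, List.map_cons, List.sum_cons, map_mul,
        hadd 2 _ (FreeGroupGrLie.map_mem_lcs π (zpow_mem (hΨ i s) _)) _ (FreeGroupGrLie.map_mem_lcs π (hmem l')), ih,
        map_zpow, theta_zpow θ hadd 2 (FreeGroupGrLie.map_mem_lcs π (hΨ i s))]
  rw [theta2_pi_congr θ hadd hker π (hmem l) h3, key]


/-- **The numerical data of the six realisers**: the surviving coordinates (`a₀, b₁, b₂`) of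
`F_k(a_{h_k})`, `F_k(b_{h_k})` and the handle-`h_k` coordinates of `F_k⁻¹` of the cut letters `b₀, a₁, a₂`,
for the six homology actions `F_k` and handles `h_k` (literal tables). [folklore] -/
theorem F_values (k : Fin 6) (j : Fin 3) :
    (![moveZ 0 1 (by decide) 1, moveZ 0 2 (by decide) 1, moveE 1, (moveZ 0 1 (by decide) 1).trans (moveZ 0 2 (by decide) 1),
      (moveE 1).symm.trans (moveZ 0 1 (by decide) 1), (moveE 1).trans (moveZ 0 2 (by decide) 1)] :
      Fin 6 → ((surfaceGen 3 → ℤ) ≃ₗ[ℤ] (surfaceGen 3 → ℤ))) k (Pi.single ((![1, 2, 1, 0, 1, 2] : Fin 6 → Fin 3) k, false) 1) ((0 : Fin 3), false) = (![![1, 0, 0], ![1, 0, 0], ![0, 0, 1], ![1, 0, 0], ![1, 0, -1], ![1, 1, 0]] : Fin 6 → Fin 3 → ℤ) k 0 ∧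
    (![moveZ 0 1 (by decide) 1, moveZ 0 2 (by decide) 1, moveE 1, (moveZ 0 1 (by decide) 1).trans (moveZ 0 2 (by decide) 1),
      (moveE 1).symm.trans (moveZ 0 1 (by decide) 1), (moveE 1).trans (moveZ 0 2 (by decide) 1)] :
      Fin 6 → ((surfaceGen 3 → ℤ) ≃ₗ[ℤ] (surfaceGen 3 → ℤ))) k (Pi.single ((![1, 2, 1, 0, 1, 2] : Fin 6 → Fin 3) k, false) 1) ((1 : Fin 3), true) = (![![1, 0, 0], ![1, 0, 0], ![0, 0, 1], ![1, 0, 0], ![1, 0, -1], ![1, 1, 0]] : Fin 6 → Fin 3 → ℤ) k 1 ∧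
    (![moveZ 0 1 (by decide) 1, moveZ 0 2 (by decide) 1, moveE 1, (moveZ 0 1 (by decide) 1).trans (moveZ 0 2 (by decide) 1),
      (moveE 1).symm.trans (moveZ 0 1 (by decide) 1), (moveE 1).trans (moveZ 0 2 (by decide) 1)] :
      Fin 6 → ((surfaceGen 3 → ℤ) ≃ₗ[ℤ] (surfaceGen 3 → ℤ))) k (Pi.single ((![1, 2, 1, 0, 1, 2] : Fin 6 → Fin 3) k, false) 1) ((2 : Fin 3), true) = (![![1, 0, 0], ![1, 0, 0], ![0, 0, 1], ![1, 0, 0], ![1, 0, -1], ![1, 1, 0]] : Fin 6 → Fin 3 → ℤ) k 2 ∧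
    (![moveZ 0 1 (by decide) 1, moveZ 0 2 (by decide) 1, moveE 1, (moveZ 0 1 (by decide) 1).trans (moveZ 0 2 (by decide) 1),
      (moveE 1).symm.trans (moveZ 0 1 (by decide) 1), (moveE 1).trans (moveZ 0 2 (by decide) 1)] :
      Fin 6 → ((surfaceGen 3 → ℤ) ≃ₗ[ℤ] (surfaceGen 3 → ℤ))) k (Pi.single ((![1, 2, 1, 0, 1, 2] : Fin 6 → Fin 3) k, true) 1) ((0 : Fin 3), false) = (![![0, 1, 0], ![0, 0, 1], ![0, 1, 0], ![0, -1, -1], ![0, 1, 0], ![0, 0, 1]] : Fin 6 → Fin 3 → ℤ) k 0 ∧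
    (![moveZ 0 1 (by decide) 1, moveZ 0 2 (by decide) 1, moveE 1, (moveZ 0 1 (by decide) 1).trans (moveZ 0 2 (by decide) 1),
      (moveE 1).symm.trans (moveZ 0 1 (by decide) 1), (moveE 1).trans (moveZ 0 2 (by decide) 1)] :
      Fin 6 → ((surfaceGen 3 → ℤ) ≃ₗ[ℤ] (surfaceGen 3 → ℤ))) k (Pi.single ((![1, 2, 1, 0, 1, 2] : Fin 6 → Fin 3) k, true) 1) ((1 : Fin 3), true) = (![![0, 1, 0], ![0, 0, 1], ![0, 1, 0], ![0, -1, -1], ![0, 1, 0], ![0, 0, 1]] : Fin 6 → Fin 3 → ℤ) k 1 ∧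
    (![moveZ 0 1 (by decide) 1, moveZ 0 2 (by decide) 1, moveE 1, (moveZ 0 1 (by decide) 1).trans (moveZ 0 2 (by decide) 1),
      (moveE 1).symm.trans (moveZ 0 1 (by decide) 1), (moveE 1).trans (moveZ 0 2 (by decide) 1)] :
      Fin 6 → ((surfaceGen 3 → ℤ) ≃ₗ[ℤ] (surfaceGen 3 → ℤ))) k (Pi.single ((![1, 2, 1, 0, 1, 2] : Fin 6 → Fin 3) k, true) 1) ((2 : Fin 3), true) = (![![0, 1, 0], ![0, 0, 1], ![0, 1, 0], ![0, -1, -1], ![0, 1, 0], ![0, 0, 1]] : Fin 6 → Fin 3 → ℤ) k 2 ∧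
    ((![moveZ 0 1 (by decide) 1, moveZ 0 2 (by decide) 1, moveE 1, (moveZ 0 1 (by decide) 1).trans (moveZ 0 2 (by decide) 1),
      (moveE 1).symm.trans (moveZ 0 1 (by decide) 1), (moveE 1).trans (moveZ 0 2 (by decide) 1)] :
      Fin 6 → ((surfaceGen 3 → ℤ) ≃ₗ[ℤ] (surfaceGen 3 → ℤ))) k).symm (Pi.single (j, (![true, false, false] : Fin 3 → Bool) j) 1) ((![1, 2, 1, 0, 1, 2] : Fin 6 → Fin 3) k, false) = (![![0, 1, 0], ![0, 0, 1], ![0, 1, 0], ![0, -1, -1], ![0, 1, 0], ![0, 0, 1]] : Fin 6 → Fin 3 → ℤ) k j ∧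
    ((![moveZ 0 1 (by decide) 1, moveZ 0 2 (by decide) 1, moveE 1, (moveZ 0 1 (by decide) 1).trans (moveZ 0 2 (by decide) 1),
      (moveE 1).symm.trans (moveZ 0 1 (by decide) 1), (moveE 1).trans (moveZ 0 2 (by decide) 1)] :
      Fin 6 → ((surfaceGen 3 → ℤ) ≃ₗ[ℤ] (surfaceGen 3 → ℤ))) k).symm (Pi.single (j, (![true, false, false] : Fin 3 → Bool) j) 1) ((![1, 2, 1, 0, 1, 2] : Fin 6 → Fin 3) k, true) = (![![1, 0, 0], ![1, 0, 0], ![0, 0, -1], ![1, 0, 0], ![1, 0, 1], ![1, -1, 0]] : Fin 6 → Fin 3 → ℤ) k j := by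
  fin_cases k <;> fin_cases j <;> refine ⟨?_, ?_, ?_, ?_, ?_, ?_, ?_, ?_⟩ <;>
    simp [moveZ, nilZ, moveE, nilE]

include hadd hker hof hbr hπof in
/-- **The six realisers and their data.** There are six Goeritz elements `U_k ∈ Stab N₀ ∩ Stab N₁` of `S₃`
lying in `𝒥₂` (`U_k(s)s⁻¹ ∈ γ₃`) whose degree-two data at the cut letters `b₀, a₁, a₂` of `N₂` — the
symbols `θ₂(π(U_k(X_j)X_j⁻¹)) ∈ L₃` — are the six twist data of the Lie side (given by their literal
coordinate table in the eight basic brackets).  They are the separating twists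
`U_k = x_k T_{h_k} x_k⁻¹`, `h = 1,2,1,0,1,2`, `x = z01, z02, e12, z01 z02, e12⁻¹ z01, e12 z02` (the landed
explicit Goeritz elements inducing `moveZ 0 1 1`, `moveZ 0 2 1`, `moveE 1`). [folklore] -/
theorem exists_realisers : ∃ U : Fin 6 → SurfaceGroup 3 ≃* SurfaceGroup 3, ∀ k : Fin 6,
    (s4Kernels 0).map (U k).toMonoidHom = s4Kernels 0 ∧ (s4Kernels 1).map (U k).toMonoidHom = s4Kernels 1 ∧
    (∀ s, U k s * s⁻¹ ∈ (⊤ : Subgroup (SurfaceGroup 3)).lowerCentralSeries 2) ∧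
    ∀ j : Fin 3, θ 2 (π (U k (PresentedGroup.of (j, (![true, false, false] : Fin 3 → Bool) j)) *
        (PresentedGroup.of (j, (![true, false, false] : Fin 3 → Bool) j) : SurfaceGroup 3)⁻¹)) =
      ∑ l, (![![![0, 0, 0, -1, 0, 0, 0, 0], ![-1, 0, 0, 0, 0, 0, 0, 0], ![0, 0, 0, 0, 0, 0, 0, 0]],
    ![![0, 0, 0, 0, 0, 0, -1, 0], ![0, 0, 0, 0, 0, 0, 0, 0], ![0, -1, 0, 0, 0, 0, 0, 0]],
    ![![0, 0, 0, 0, 0, 0, 0, 0], ![0, 0, 0, 0, 0, 0, 0, 1], ![0, 0, 0, 0, -1, 0, 0, 0]],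
    ![![0, 0, -1, -1, 0, -2, -1, 0], ![-1, -1, 0, 0, 0, 0, 0, 0], ![-1, -1, 0, 0, 0, 0, 0, 0]],
    ![![0, 0, 0, -1, -1, 0, 0, 0], ![-1, 0, -1, 0, 0, 1, 0, 1], ![0, 0, 0, -1, -1, 0, 0, 0]],
    ![![0, 0, 0, 0, 0, 0, -1, -1], ![0, 0, 0, 0, 0, 0, 1, 1], ![0, -1, -2, 0, -1, -1, 0, 0]]] : Fin 6 → Fin 3 → Fin 8 → ℤ) k j l • (![⁅FreeLieAlgebra.of ℤ (0 : Fin 3), ⁅FreeLieAlgebra.of ℤ (0 : Fin 3), FreeLieAlgebra.of ℤ (1 : Fin 3)⁆⁆,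
    ⁅FreeLieAlgebra.of ℤ (0 : Fin 3), ⁅FreeLieAlgebra.of ℤ (0 : Fin 3), FreeLieAlgebra.of ℤ (2 : Fin 3)⁆⁆,
    ⁅FreeLieAlgebra.of ℤ (0 : Fin 3), ⁅FreeLieAlgebra.of ℤ (1 : Fin 3), FreeLieAlgebra.of ℤ (2 : Fin 3)⁆⁆,
    ⁅FreeLieAlgebra.of ℤ (1 : Fin 3), ⁅FreeLieAlgebra.of ℤ (0 : Fin 3), FreeLieAlgebra.of ℤ (1 : Fin 3)⁆⁆,
    ⁅FreeLieAlgebra.of ℤ (1 : Fin 3), ⁅FreeLieAlgebra.of ℤ (1 : Fin 3), FreeLieAlgebra.of ℤ (2 : Fin 3)⁆⁆,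
    ⁅FreeLieAlgebra.of ℤ (2 : Fin 3), ⁅FreeLieAlgebra.of ℤ (0 : Fin 3), FreeLieAlgebra.of ℤ (1 : Fin 3)⁆⁆,
    ⁅FreeLieAlgebra.of ℤ (2 : Fin 3), ⁅FreeLieAlgebra.of ℤ (0 : Fin 3), FreeLieAlgebra.of ℤ (2 : Fin 3)⁆⁆,
    ⁅FreeLieAlgebra.of ℤ (2 : Fin 3), ⁅FreeLieAlgebra.of ℤ (1 : Fin 3), FreeLieAlgebra.of ℤ (2 : Fin 3)⁆⁆] :
      Fin 8 → FreeLieAlgebra ℤ (Fin 3)) l := by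
  choose T hT0 hT1 hT2 hTh hTne using exists_twist
  obtain ⟨a0, a1, ha⟩ := z01_goeritz
  obtain ⟨b0, b1, hb⟩ := z02_goeritz
  obtain ⟨c0, c1, hc⟩ := e12_goeritz
  set x : Fin 6 → SurfaceGroup 3 ≃* SurfaceGroup 3 :=
    ![z01.toMulEquiv, z02.toMulEquiv, e12.toMulEquiv, z01.toMulEquiv.trans z02.toMulEquiv,
      e12.toMulEquiv.symm.trans z01.toMulEquiv, e12.toMulEquiv.trans z02.toMulEquiv] with hx
  set F : Fin 6 → ((surfaceGen 3 → ℤ) ≃ₗ[ℤ] (surfaceGen 3 → ℤ)) := (![moveZ 0 1 (by decide) 1, moveZ 0 2 (by decide) 1, moveE 1, (moveZ 0 1 (by decide) 1).trans (moveZ 0 2 (by decide) 1),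
      (moveE 1).symm.trans (moveZ 0 1 (by decide) 1), (moveE 1).trans (moveZ 0 2 (by decide) 1)] :
      Fin 6 → ((surfaceGen 3 → ℤ) ≃ₗ[ℤ] (surfaceGen 3 → ℤ))) with hF
  set hh : Fin 6 → Fin 3 := (![1, 2, 1, 0, 1, 2] : Fin 6 → Fin 3) with hhh
  have hxg : ∀ k, (s4Kernels 0).map (x k).toMonoidHom = s4Kernels 0 ∧ (s4Kernels 1).map (x k).toMonoidHom = s4Kernels 1 ∧
      ∀ s, toAdd (SurfaceGroup.abelianize 3 (x k s)) = F k (toAdd (SurfaceGroup.abelianize 3 s)) := by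
    intro k
    fin_cases k <;> simp only [hx, hF, Matrix.cons_val, Fin.zero_eta, Fin.mk_one, Fin.reduceFinMk, Fin.isValue]
    · exact ⟨a0, a1, ha⟩
    · exact ⟨b0, b1, hb⟩
    · exact ⟨c0, c1, hc⟩
    · exact ⟨by rw [map_trans, a0, b0], by rw [map_trans, a1, b1], realises_trans ha hb⟩
    · exact ⟨by rw [map_trans, map_symm_of_map _ c0, a0], by rw [map_trans, map_symm_of_map _ c1, a1],
        realises_trans (realises_symm hc) ha⟩
    · exact ⟨by rw [map_trans, c0, b0], by rw [map_trans, c1, b1], realises_trans hc hb⟩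
  refine ⟨fun k => (x k).symm.trans ((T (hh k)).trans (x k)), fun k => ⟨?_, ?_, fun s => ?_, fun j => ?_⟩⟩
  · exact map_conj_of_map_eq _ _ (hxg k).1 (hT0 _)
  · exact map_conj_of_map_eq _ _ (hxg k).2.1 (hT1 _)
  · rw [conj_tau]; exact equiv_mem_lcs _ (hT2 _ _)
  · obtain ⟨u0, u1, u2, v0, v1, v2, na, nb⟩ := F_values k j
    rw [datum_conj_twist θ hadd hker hof hbr π hπof (x k) (T (hh k)) (F k) (hxg k).2.2 (hh k) (hT2 _) (hTh _)
      (hTne _) j, hF, hhh, u0, u1, u2, v0, v1, v2, na, nb]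
    fin_cases k <;> fin_cases j <;>
      simp only [Fin.sum_univ_eight, Matrix.cons_val, Fin.zero_eta, Fin.mk_one, Fin.reduceFinMk, Fin.isValue, zero_smul,
        one_smul, neg_smul, add_zero, zero_add, lie_add, add_lie, lie_neg, neg_lie, lie_lie_eq_neg, inner_21,
        jacobi_102, neg_neg, neg_add, smul_add, smul_neg, neg_zero] <;>
      module

end Symbols

end LayerZeroOne


/-- **Registered helper `helper_johnsonTwoDataAdd`** (sub-goal of stub `stub_layerStepZeroOne`, item
stmt-SmoothPoincare4-14595): data add on `𝒥₂` — for the Magnus–Witt symbols `θ` of `F₃` (any maps additive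
on `γₖ₊₁` with kernel `γₖ₊₂` there) and any `π : S₃ → F₃`, the degree-two symbol of the value at `s` of a
product of powers of elements of `𝒥₂` is the corresponding combination of the symbols. [folklore] -/
theorem helper_johnsonTwoDataAdd : ∀ (θ : ℕ → FreeGroup (Fin 3) → FreeLieAlgebra ℤ (Fin 3)), (∀ k, ∀ x ∈ (⊤ : Subgroup (FreeGroup (Fin 3))).lowerCentralSeries k, ∀ y ∈ (⊤ : Subgroup (FreeGroup (Fin 3))).lowerCentralSeries k, θ k (x * y) = θ k x + θ k y) → (∀ k, ∀ x ∈ (⊤ : Subgroup (FreeGroup (Fin 3))).lowerCentralSeries k, θ k x = 0 ↔ x ∈ (⊤ : Subgroup (FreeGroup (Fin 3))).lowerCentralSeries (k + 1)) → ∀ (π : SurfaceGroup 3 →* FreeGroup (Fin 3)) (n : ℕ) (l : List (Fin n)) (Ψ : Fin n → SurfaceGroup 3 ≃* SurfaceGroup 3) (e : Fin n → ℤ), (∀ i, ∀ s : SurfaceGroup 3, Ψ i s * s⁻¹ ∈ (⊤ : Subgroup (SurfaceGroup 3)).lowerCentralSeries 2) → ∀ s : SurfaceGroup 3, (∀ s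 : SurfaceGroup 3, (l.map fun i => ((Ψ i : MulAut (SurfaceGroup 3)) ^ e i : MulAut (SurfaceGroup 3))).prod s * s⁻¹ ∈ (⊤ : Subgroup (SurfaceGroup 3)).lowerCentralSeries 2) ∧ θ 2 (π ((l.map fun i => ((Ψ i : MulAut (SurfaceGroup 3)) ^ e i : MulAut (SurfaceGroup 3))).prod s * s⁻¹)) = (l.map fun i => e i • θ 2 (π (Ψ i s * s⁻¹))).sum :=
  fun θ hadd hker π _ l Ψ e hΨ s => LayerZeroOne.datum_list_prod_zpow θ hadd hker π l Ψ e hΨ s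

end Summit.SmoothPoincare4.SmoothPoincare4.Theorems.ShadowApproximation.NilpotentGenusClass

end
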